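import Summits.QuantumFields.YangMills.Theorems.BalabanLadderNTReferenceTransferTemperedCumulant
import Summits.QuantumFields.YangMills.Theorems.BalabanLadderNTReferenceTorusTempered
import Summits.QuantumFields.YangMills.Theorems.BalabanLadderNTReferenceTransferCumulant
import HarnessLib

/-!
# Seam `UVSeamRec` (stmt-QuantumFields-20043): TEMPERED three-point torus transfer — exterior oscillations only on a
# GOOD set of exteriors of the transfer cube, rarity of the bad set under Wilson's measure on each torus

Helper file (`--supports stmt-QuantumFields-20043`; owner R78: THREE-POINT CONJUNCT supplier; lead ym-spine-20043-p1
g7 09:44Z located suggestion «tempered twin of `Reference.abs_torusK3_sub_kerK3_le`») of the fleet lead prover of crux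
`NT` (unit `ym-spine-19353-p1`, g5); route-independent.  CLAUSE SERVED: conjunct 3 (three-point floor) of the
registered v4-F `stub_floorsEngine` in TEMPERED currency — the tempered twins of g4's
`abs_torusK3_sub_torusE_kerK3_le` / `abs_torusK3_sub_torusK3_le` (`…NTReferenceTransferCumulant.lean`): the
one-point / covariance / third-cumulant oscillation ceilings of the transfer cube `P` are assumed only for exteriors in
a measurable set `Good` and the complement is paid by its mass `δ` under Wilson's measure of each torus, via the
generic tempered law of total cumulance (`…TransferTemperedCumulant.lean`).  Bounds of the conditional data:
`|kerE dens| ≤ M`, `|kerCov| ≤ 2M²` (`abs_kerCov_le`), `|kerK3| ≤ 6M³` (`abs_kerK3_le`).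

* `abs_torusK3_sub_torusE_kerK3_le_on` — `≤ B_g + B_b δ`, `B_g = Σ kᵢ′w_{jk}′ + ∏kᵢ′` (`k′ = k + 2Mδ`,
  `w′ = w + 4M²δ`), `B_b = 24M³ + 8M³ = 32M³`... precisely `4(M·2M² ×3) + 8M³`;
* `abs_torusK3_sub_torusK3_le_on` — two tori: `≤ 2(B_g + B_bδ) + (ω₃ + 2·6M³·(δ+δ))`;
* `triple_transfer_torus_tempered` — per triple of action densities at coupling `β`: E1/E2/E3-osc ON `Good` for the
  transfer cube only (`k = C₁(α/κ)⁴`, `w = C₂(α/κ)⁴/(1+‖·‖)⁴`, `ω₃ = C₃(α/κ)⁴/(1+min sep)⁸`) + rarity `δ`.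

The `∀ L` floor statement (tempered `q3_floor_of_torusReference`) = the successor's next file (HANDOFF of g5); at
`Good = univ`, `δ = 0` everything reduces to g4.

Refs: lead line fleet INBOX 2026-08-27T09:44:53Z; g4 `…NTReferenceTransferCumulant.lean`.
-/

set_option autoImplicit false

noncomputable section

open scoped SchwartzMap
open MeasureTheory Filter Topology
open Literature.MathematicalPhysics.QuantumFieldTheory Literature.MathematicalPhysics.QuantumLattice
open Literature.Probability.LatticeModels
open Summit.QuantumFields.YangMills.Cruxes.OSLegsFromFemtoAndGap.DlrCollarTransfer
open Summit.QuantumFields.YangMills.Cruxes.OSLegsFromFemtoAndGap.DlrCollarTransfer.StubLower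
  (isCylinder_mul isCylinder_dens)
open Summit.QuantumFields.YangMills.Cruxes.OSLegsAtWeakCouplingC.InheritedAmplitudeGates.StubInherit
  (integral_lift_eq_integral_kerE_cube)
open Summit.QuantumFields.YangMills.Cruxes.NT.BoundaryLaw (abs_kerE_le)

namespace Summit.QuantumFields.YangMills.Cruxes.NT.Reference

section Torus

variable (G : Type) [Group G] [TopologicalSpace G] [IsTopologicalGroup G] [CompactSpace G]
  [MeasurableSpace G] [BorelSpace G] (r : LatticeRep G)

/-- The cube-kernel third cumulant of three densities bounded by `M` is bounded by `6M³`. [folklore] -/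
theorem abs_kerK3_le (β : ℝ) (c : Fin 4 → ℤ) (b : ℕ) (ζ : LGConfig 4 G) {M : ℝ}
    (hM : ∀ (x : Fin 4 → ℤ) (U : LGConfig 4 G), |dens G r x U| ≤ M) (x y z : Fin 4 → ℤ) :
    |kerK3 G r β c b ζ x y z| ≤ 6 * (M * M * M) := by
  have bxy : ∀ U, |dens G r x U * dens G r y U| ≤ M * M := abs_mul_le_of_abs_le G (hM x) (hM y)
  have bxz : ∀ U, |dens G r x U * dens G r z U| ≤ M * M := abs_mul_le_of_abs_le G (hM x) (hM z)
  have byz : ∀ U, |dens G r y U * dens G r z U| ≤ M * M := abs_mul_le_of_abs_le G (hM y) (hM z)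
  have bxyz : ∀ U, |dens G r x U * dens G r y U * dens G r z U| ≤ M * M * M := abs_mul_le_of_abs_le G bxy (hM z)
  have e123 := abs_kerE_le G r β c b ζ bxyz
  have e1 := abs_kerE_le G r β c b ζ (hM x)
  have e2 := abs_kerE_le G r β c b ζ (hM y)
  have e3 := abs_kerE_le G r β c b ζ (hM z)
  have e23 := abs_kerE_le G r β c b ζ byz
  have e13 := abs_kerE_le G r β c b ζ bxz
  have e12 := abs_kerE_le G r β c b ζ bxy
  have hM0 : 0 ≤ M := (abs_nonneg _).trans e1
  have amul : ∀ {p q u w : ℝ}, |p| ≤ u → |q| ≤ w → |p * q| ≤ u * w := fun hp hq => by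
    rw [abs_mul]; exact mul_le_mul hp hq (abs_nonneg _) ((abs_nonneg _).trans hp)
  have t1 := amul e1 e23
  have t2 := amul e2 e13
  have t3 := amul e3 e12
  have t4 := amul (amul e1 e2) e3
  unfold kerK3
  have s1 := abs_sub (kerE G r β c b ζ (fun U => dens G r x U * dens G r y U * dens G r z U)
      - kerE G r β c b ζ (dens G r x) * kerE G r β c b ζ (fun U => dens G r y U * dens G r z U)
      - kerE G r β c b ζ (dens G r y) * kerE G r β c b ζ (fun U => dens G r x U * dens G r z U)
      - kerE G r β c b ζ (dens G r z) * kerE G r β c b ζ (fun U => dens G r x U * dens G r y U))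
    (-(2 * (kerE G r β c b ζ (dens G r x) * kerE G r β c b ζ (dens G r y) * kerE G r β c b ζ (dens G r z))))
  have s2 := abs_sub (kerE G r β c b ζ (fun U => dens G r x U * dens G r y U * dens G r z U)
      - kerE G r β c b ζ (dens G r x) * kerE G r β c b ζ (fun U => dens G r y U * dens G r z U)
      - kerE G r β c b ζ (dens G r y) * kerE G r β c b ζ (fun U => dens G r x U * dens G r z U))
    (kerE G r β c b ζ (dens G r z) * kerE G r β c b ζ (fun U => dens G r x U * dens G r y U))
  have s3 := abs_sub (kerE G r β c b ζ (fun U => dens G r x U * dens G r y U * dens G r z U)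
      - kerE G r β c b ζ (dens G r x) * kerE G r β c b ζ (fun U => dens G r y U * dens G r z U))
    (kerE G r β c b ζ (dens G r y) * kerE G r β c b ζ (fun U => dens G r x U * dens G r z U))
  have s4 := abs_sub (kerE G r β c b ζ (fun U => dens G r x U * dens G r y U * dens G r z U))
    (kerE G r β c b ζ (dens G r x) * kerE G r β c b ζ (fun U => dens G r y U * dens G r z U))
  have hneg : |(-(2 * (kerE G r β c b ζ (dens G r x) * kerE G r β c b ζ (dens G r y) * kerE G r β c b ζ (dens G r z))))|
      ≤ 2 * (M * M * M) := by
    rw [abs_neg, abs_mul, abs_two]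
    linarith
  rw [sub_eq_add_neg _ (-(2 * _))] at s1
  simp only [neg_neg] at s1
  have : |kerE G r β c b ζ (fun U => dens G r x U * dens G r y U * dens G r z U)
      - kerE G r β c b ζ (dens G r x) * kerE G r β c b ζ (fun U => dens G r y U * dens G r z U)
      - kerE G r β c b ζ (dens G r y) * kerE G r β c b ζ (fun U => dens G r x U * dens G r z U)
      - kerE G r β c b ζ (dens G r z) * kerE G r β c b ζ (fun U => dens G r x U * dens G r y U)
      + 2 * (kerE G r β c b ζ (dens G r x) * kerE G r β c b ζ (dens G r y) * kerE G r β c b ζ (dens G r z))|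
      ≤ |kerE G r β c b ζ (fun U => dens G r x U * dens G r y U * dens G r z U)
          - kerE G r β c b ζ (dens G r x) * kerE G r β c b ζ (fun U => dens G r y U * dens G r z U)
          - kerE G r β c b ζ (dens G r y) * kerE G r β c b ζ (fun U => dens G r x U * dens G r z U)
          - kerE G r β c b ζ (dens G r z) * kerE G r β c b ζ (fun U => dens G r x U * dens G r y U)|
        + |2 * (kerE G r β c b ζ (dens G r x) * kerE G r β c b ζ (dens G r y) * kerE G r β c b ζ (dens G r z))| :=
    abs_add_le _ _
  have h2abs : |2 * (kerE G r β c b ζ (dens G r x) * kerE G r β c b ζ (dens G r y) * kerE G r β c b ζ (dens G r z))|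
      ≤ 2 * (M * M * M) := by
    rw [abs_mul, abs_two]; linarith
  linarith

/-- **TEMPERED torus ↔ mean of cube-kernel third cumulants.**  A cube `P = (c₀, b₀)` in a torus `2L+1 ≥ b₀+3`, sites
`x, y, z` of depth `≥ 1` in `P`, densities bounded by `M`, a measurable set `Good` of exteriors with bad mass `≤ δ`
(Wilson's measure read through the lift), and ON `Good`: one-point oscillations `≤ k`'s, covariance oscillations
`≤ w`'s (all `≥ 0`).  Then `|torusK3_L(x,y,z) − torusE_L(kerK3_P^ζ(x,y,z))| ≤ B_g + B_b δ` with
`B_g = Σ (kᵢ + 2Mδ)(w_{jk} + 2(2M²)δ) + ∏ (kᵢ + 2Mδ)`, `B_b = 4·3·M·2M² + 8M³`. [folklore] -/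
theorem abs_torusK3_sub_torusE_kerK3_le_on (β : ℝ) (c₀ : Fin 4 → ℤ) (b₀ L : ℕ) (hL : b₀ + 3 ≤ 2 * L + 1)
    {x y z : Fin 4 → ℤ} (hx : 1 ≤ depth c₀ b₀ x) (hy : 1 ≤ depth c₀ b₀ y) (hz : 1 ≤ depth c₀ b₀ z) {M : ℝ}
    (hM : ∀ (u : Fin 4 → ℤ) (U : LGConfig 4 G), |dens G r u U| ≤ M)
    {Good : Set (LGConfig 4 G)} (hGood : MeasurableSet Good) {δ : ℝ}
    (hδ : (wilsonMeasure (d := 4) (L := 2 * L + 1) r.ρ β).real ((torusLift (2 * L + 1)) ⁻¹' Good)ᶜ ≤ δ)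
    {kx ky kz wyz wxz wxy : ℝ} (hkx : 0 ≤ kx) (hky : 0 ≤ ky) (hkz : 0 ≤ kz) (hwyz0 : 0 ≤ wyz) (hwxz0 : 0 ≤ wxz)
    (hwxy0 : 0 ≤ wxy)
    (hox : ∀ ζ ∈ Good, ∀ ζ' ∈ Good, |kerE G r β c₀ b₀ ζ (dens G r x) - kerE G r β c₀ b₀ ζ' (dens G r x)| ≤ kx)
    (hoy : ∀ ζ ∈ Good, ∀ ζ' ∈ Good, |kerE G r β c₀ b₀ ζ (dens G r y) - kerE G r β c₀ b₀ ζ' (dens G r y)| ≤ ky)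
    (hoz : ∀ ζ ∈ Good, ∀ ζ' ∈ Good, |kerE G r β c₀ b₀ ζ (dens G r z) - kerE G r β c₀ b₀ ζ' (dens G r z)| ≤ kz)
    (hoyz : ∀ ζ ∈ Good, ∀ ζ' ∈ Good, |kerCov G r β c₀ b₀ ζ (dens G r y) (dens G r z) -
      kerCov G r β c₀ b₀ ζ' (dens G r y) (dens G r z)| ≤ wyz)
    (hoxz : ∀ ζ ∈ Good, ∀ ζ' ∈ Good, |kerCov G r β c₀ b₀ ζ (dens G r x) (dens G r z) -
      kerCov G r β c₀ b₀ ζ' (dens G r x) (dens G r z)| ≤ wxz)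
    (hoxy : ∀ ζ ∈ Good, ∀ ζ' ∈ Good, |kerCov G r β c₀ b₀ ζ (dens G r x) (dens G r y) -
      kerCov G r β c₀ b₀ ζ' (dens G r x) (dens G r y)| ≤ wxy) :
    |torusK3 G r β L x y z - torusE G r β L (fun ζ => kerK3 G r β c₀ b₀ ζ x y z)| ≤
      ((kx + 2 * M * δ) * (wyz + 2 * (2 * M * M) * δ) + (ky + 2 * M * δ) * (wxz + 2 * (2 * M * M) * δ)
          + (kz + 2 * M * δ) * (wxy + 2 * (2 * M * M) * δ) + (kx + 2 * M * δ) * (ky + 2 * M * δ) * (kz + 2 * M * δ))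
        + (4 * (M * (2 * M * M) + M * (2 * M * M) + M * (2 * M * M)) + 8 * M * M * M) * δ := by
  classical
  haveI := r.secondCountableTopology
  haveI := isProbabilityMeasure_wilsonMeasure (d := 4) (L := 2 * L + 1) r.ρ r.continuous β
  have cx := continuous_dens r x
  have cy := continuous_dens r y
  have cz := continuous_dens r z
  have cxy : Continuous fun U => dens G r x U * dens G r y U := cx.mul cy
  have cxz : Continuous fun U => dens G r x U * dens G r z U := cx.mul cz
  have cyz : Continuous fun U => dens G r y U * dens G r z U := cy.mul cz
  have cxyz : Continuous fun U => dens G r x U * dens G r y U * dens G r z U := cxy.mul cz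
  have bxy : ∀ U, |dens G r x U * dens G r y U| ≤ M * M := abs_mul_le_of_abs_le G (hM x) (hM y)
  have bxz : ∀ U, |dens G r x U * dens G r z U| ≤ M * M := abs_mul_le_of_abs_le G (hM x) (hM z)
  have byz : ∀ U, |dens G r y U * dens G r z U| ≤ M * M := abs_mul_le_of_abs_le G (hM y) (hM z)
  have bxyz : ∀ U, |dens G r x U * dens G r y U * dens G r z U| ≤ M * M * M :=
    abs_mul_le_of_abs_le G bxy (hM z)
  have wx := dens_supp_window_of_depth_pos G r hx
  have wy := dens_supp_window_of_depth_pos G r hy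
  have wz := dens_supp_window_of_depth_pos G r hz
  have T : ∀ {F : LGConfig 4 G → ℝ}, Continuous F → ∀ {C : ℝ}, (∀ U, |F U| ≤ C) →
      ∀ {S : Finset (Literature.MathematicalPhysics.QuantumLattice.ZdEdge 4)}, IsCylinder F S →
      (∀ e ∈ S, ∀ j, c₀ j ≤ e.1 j ∧ e.1 j ≤ c₀ j + b₀) →
      ∫ U, F (torusLift (2 * L + 1) U) ∂(wilsonMeasure (d := 4) (L := 2 * L + 1) r.ρ β) =
        ∫ U, kerE G r β c₀ b₀ (torusLift (2 * L + 1) U) F ∂(wilsonMeasure (d := 4) (L := 2 * L + 1) r.ρ β) :=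
    fun hF C hC S hS hW => integral_lift_eq_integral_kerE_cube G r β c₀ b₀ (2 * L + 1) hL hF hC hS hW
  have ex := T cx (hM x) (isCylinder_dens G r x) wx
  have ey := T cy (hM y) (isCylinder_dens G r y) wy
  have ez := T cz (hM z) (isCylinder_dens G r z) wz
  have exy := T cxy bxy (isCylinder_mul (isCylinder_dens G r x) (isCylinder_dens G r y)) (window_union wx wy)
  have exz := T cxz bxz (isCylinder_mul (isCylinder_dens G r x) (isCylinder_dens G r z)) (window_union wx wz)
  have eyz := T cyz byz (isCylinder_mul (isCylinder_dens G r y) (isCylinder_dens G r z)) (window_union wy wz)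
  have exyz := T cxyz bxyz
    (isCylinder_mul (isCylinder_mul (isCylinder_dens G r x) (isCylinder_dens G r y)) (isCylinder_dens G r z))
    (window_union (window_union wx wy) wz)
  have C : ∀ {F : LGConfig 4 G → ℝ}, Continuous F → ∀ {C : ℝ}, (∀ U, |F U| ≤ C) →
      Continuous fun U : GaugeConfig 4 (2 * L + 1) G => kerE G r β c₀ b₀ (torusLift (2 * L + 1) U) F :=
    fun hF C hC => continuous_kerE_torusLift G r β c₀ b₀ (2 * L + 1) hF hC
  have hS := (continuous_torusLift (d := 4) (G := G) (2 * L + 1)).measurable hGood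
  have key := abs_cum3_sub_integral_condCum3_le_of_osc_on (μ := wilsonMeasure (d := 4) (L := 2 * L + 1) r.ρ β)
    (C cx (hM x)) (C cy (hM y)) (C cz (hM z)) (C cxy bxy) (C cxz bxz) (C cyz byz) (C cxyz bxyz) hS hδ
    (M₁ := M) (M₂ := M) (M₃ := M) (M₂₃ := 2 * M * M) (M₁₃ := 2 * M * M) (M₁₂ := 2 * M * M)
    (fun U => abs_kerE_le G r β c₀ b₀ _ (hM x)) (fun U => abs_kerE_le G r β c₀ b₀ _ (hM y))
    (fun U => abs_kerE_le G r β c₀ b₀ _ (hM z))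
    (fun U => by simpa only [kerCov] using abs_kerCov_le G r β c₀ b₀ (torusLift (2 * L + 1) U) (hM y) (hM z))
    (fun U => by simpa only [kerCov] using abs_kerCov_le G r β c₀ b₀ (torusLift (2 * L + 1) U) (hM x) (hM z))
    (fun U => by simpa only [kerCov] using abs_kerCov_le G r β c₀ b₀ (torusLift (2 * L + 1) U) (hM x) (hM y))
    hkx hky hkz hwxy0 hwxz0 hwyz0
    (fun U hU V hV => hox _ hU _ hV) (fun U hU V hV => hoy _ hU _ hV) (fun U hU V hV => hoz _ hU _ hV)
    (fun U hU V hV => by simpa only [kerCov] using hoyz (torusLift (2 * L + 1) U) hU (torusLift (2 * L + 1) V) hV)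
    (fun U hU V hV => by simpa only [kerCov] using hoxz (torusLift (2 * L + 1) U) hU (torusLift (2 * L + 1) V) hV)
    (fun U hU V hV => by simpa only [kerCov] using hoxy (torusLift (2 * L + 1) U) hU (torusLift (2 * L + 1) V) hV)
  simp only [torusK3, torusE]
  rw [exyz, ex, ey, ez, eyz, exz, exy]
  simp only [kerK3] at key ⊢
  exact key

/-- **TEMPERED two tori compared, third cumulant.**  A cube `P` inside two tori of sides `2L+1, 2L'+1 ≥ b₀+3`, both
bad masses `≤ δ`, data as above plus the third-cumulant oscillation `≤ ω₃` on `Good` (`ω₃ ≥ 0`):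
`|torusK3_L − torusK3_{L'}| ≤ 2(B_g + B_bδ) + (ω₃ + 2·6M³·(δ + δ))`. [folklore] -/
theorem abs_torusK3_sub_torusK3_le_on (β : ℝ) (c₀ : Fin 4 → ℤ) (b₀ L L' : ℕ) (hL : b₀ + 3 ≤ 2 * L + 1)
    (hL' : b₀ + 3 ≤ 2 * L' + 1)
    {x y z : Fin 4 → ℤ} (hx : 1 ≤ depth c₀ b₀ x) (hy : 1 ≤ depth c₀ b₀ y) (hz : 1 ≤ depth c₀ b₀ z) {M : ℝ}
    (hM : ∀ (u : Fin 4 → ℤ) (U : LGConfig 4 G), |dens G r u U| ≤ M)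
    {Good : Set (LGConfig 4 G)} (hGood : MeasurableSet Good) {δ : ℝ}
    (hδ : (wilsonMeasure (d := 4) (L := 2 * L + 1) r.ρ β).real ((torusLift (2 * L + 1)) ⁻¹' Good)ᶜ ≤ δ)
    (hδ' : (wilsonMeasure (d := 4) (L := 2 * L' + 1) r.ρ β).real ((torusLift (2 * L' + 1)) ⁻¹' Good)ᶜ ≤ δ)
    {kx ky kz wyz wxz wxy ω₃ : ℝ} (hkx : 0 ≤ kx) (hky : 0 ≤ ky) (hkz : 0 ≤ kz) (hwyz0 : 0 ≤ wyz)
    (hwxz0 : 0 ≤ wxz) (hwxy0 : 0 ≤ wxy) (hω₃ : 0 ≤ ω₃)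
    (hox : ∀ ζ ∈ Good, ∀ ζ' ∈ Good, |kerE G r β c₀ b₀ ζ (dens G r x) - kerE G r β c₀ b₀ ζ' (dens G r x)| ≤ kx)
    (hoy : ∀ ζ ∈ Good, ∀ ζ' ∈ Good, |kerE G r β c₀ b₀ ζ (dens G r y) - kerE G r β c₀ b₀ ζ' (dens G r y)| ≤ ky)
    (hoz : ∀ ζ ∈ Good, ∀ ζ' ∈ Good, |kerE G r β c₀ b₀ ζ (dens G r z) - kerE G r β c₀ b₀ ζ' (dens G r z)| ≤ kz)
    (hoyz : ∀ ζ ∈ Good, ∀ ζ' ∈ Good, |kerCov G r β c₀ b₀ ζ (dens G r y) (dens G r z) -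
      kerCov G r β c₀ b₀ ζ' (dens G r y) (dens G r z)| ≤ wyz)
    (hoxz : ∀ ζ ∈ Good, ∀ ζ' ∈ Good, |kerCov G r β c₀ b₀ ζ (dens G r x) (dens G r z) -
      kerCov G r β c₀ b₀ ζ' (dens G r x) (dens G r z)| ≤ wxz)
    (hoxy : ∀ ζ ∈ Good, ∀ ζ' ∈ Good, |kerCov G r β c₀ b₀ ζ (dens G r x) (dens G r y) -
      kerCov G r β c₀ b₀ ζ' (dens G r x) (dens G r y)| ≤ wxy)
    (ho3 : ∀ ζ ∈ Good, ∀ ζ' ∈ Good, |kerK3 G r β c₀ b₀ ζ x y z - kerK3 G r β c₀ b₀ ζ' x y z| ≤ ω₃) :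
    |torusK3 G r β L x y z - torusK3 G r β L' x y z| ≤
      2 * (((kx + 2 * M * δ) * (wyz + 2 * (2 * M * M) * δ) + (ky + 2 * M * δ) * (wxz + 2 * (2 * M * M) * δ)
          + (kz + 2 * M * δ) * (wxy + 2 * (2 * M * M) * δ) + (kx + 2 * M * δ) * (ky + 2 * M * δ) * (kz + 2 * M * δ))
        + (4 * (M * (2 * M * M) + M * (2 * M * M) + M * (2 * M * M)) + 8 * M * M * M) * δ)
      + (ω₃ + 2 * (6 * (M * M * M)) * (δ + δ)) := by
  haveI := r.secondCountableTopology
  haveI := isProbabilityMeasure_wilsonMeasure (d := 4) (L := 2 * L + 1) r.ρ r.continuous β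
  haveI := isProbabilityMeasure_wilsonMeasure (d := 4) (L := 2 * L' + 1) r.ρ r.continuous β
  have t1 := abs_torusK3_sub_torusE_kerK3_le_on G r β c₀ b₀ L hL hx hy hz hM hGood hδ hkx hky hkz hwyz0 hwxz0 hwxy0
    hox hoy hoz hoyz hoxz hoxy
  have t2 := abs_torusK3_sub_torusE_kerK3_le_on G r β c₀ b₀ L' hL' hx hy hz hM hGood hδ' hkx hky hkz hwyz0 hwxz0
    hwxy0 hox hoy hoz hoyz hoxz hoxy
  have cx := continuous_dens r x
  have cy := continuous_dens r y
  have cz := continuous_dens r z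
  have cxy : Continuous fun U => dens G r x U * dens G r y U := cx.mul cy
  have cxz : Continuous fun U => dens G r x U * dens G r z U := cx.mul cz
  have cyz : Continuous fun U => dens G r y U * dens G r z U := cy.mul cz
  have cxyz : Continuous fun U => dens G r x U * dens G r y U * dens G r z U := cxy.mul cz
  have bxy : ∀ U, |dens G r x U * dens G r y U| ≤ M * M := abs_mul_le_of_abs_le G (hM x) (hM y)
  have bxz : ∀ U, |dens G r x U * dens G r z U| ≤ M * M := abs_mul_le_of_abs_le G (hM x) (hM z)
  have byz : ∀ U, |dens G r y U * dens G r z U| ≤ M * M := abs_mul_le_of_abs_le G (hM y) (hM z)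
  have bxyz : ∀ U, |dens G r x U * dens G r y U * dens G r z U| ≤ M * M * M :=
    abs_mul_le_of_abs_le G bxy (hM z)
  have hcont : Continuous fun ζ => kerK3 G r β c₀ b₀ ζ x y z := by
    unfold kerK3
    have k1 := continuous_kerE G r β c₀ b₀ cx (hM x)
    have k2 := continuous_kerE G r β c₀ b₀ cy (hM y)
    have k3 := continuous_kerE G r β c₀ b₀ cz (hM z)
    have k12 := continuous_kerE G r β c₀ b₀ cxy bxy
    have k13 := continuous_kerE G r β c₀ b₀ cxz bxz
    have k23 := continuous_kerE G r β c₀ b₀ cyz byz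
    have k123 := continuous_kerE G r β c₀ b₀ cxyz bxyz
    exact (((k123.sub (k1.mul k23)).sub (k2.mul k13)).sub (k3.mul k12)).add
      (continuous_const.mul ((k1.mul k2).mul k3))
  have t3 : |torusE G r β L (fun ζ => kerK3 G r β c₀ b₀ ζ x y z) -
      torusE G r β L' (fun ζ => kerK3 G r β c₀ b₀ ζ x y z)| ≤ ω₃ + 2 * (6 * (M * M * M)) * (δ + δ) := by
    unfold torusE
    exact abs_integral_sub_integral_le_of_osc_on (hcont.comp (continuous_torusLift _))
      (hcont.comp (continuous_torusLift _)) ((continuous_torusLift (d := 4) (G := G) (2 * L + 1)).measurable hGood)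
      ((continuous_torusLift (d := 4) (G := G) (2 * L' + 1)).measurable hGood) hω₃
      (fun U => abs_kerK3_le G r β c₀ b₀ _ hM x y z) (fun V => abs_kerK3_le G r β c₀ b₀ _ hM x y z)
      (fun U hU V hV => ho3 _ hU _ hV) hδ hδ'
  have tri := abs_sub_le (torusK3 G r β L x y z) (torusE G r β L (fun ζ => kerK3 G r β c₀ b₀ ζ x y z))
    (torusK3 G r β L' x y z)
  have tri₂ := abs_sub_le (torusE G r β L (fun ζ => kerK3 G r β c₀ b₀ ζ x y z))
    (torusE G r β L' (fun ζ => kerK3 G r β c₀ b₀ ζ x y z)) (torusK3 G r β L' x y z)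
  rw [abs_sub_comm] at t2
  linarith

/-- **TEMPERED per-triple transfer for three action densities.**  Transfer cube `P` of radius `RP` in two tori
`2L+1, 2L'+1 ⊇ P`; sites `x, y, z` of depth `≥ κ/α` (`≥ 1`) in `P`; densities bounded by `M`; a measurable set `Good`
of exteriors of `P` with bad mass `≤ δ` on both tori; ON `Good`: E1-osc (`C₁/depth⁴`), E2-osc
(`C₂/min depth⁴/(1+‖·‖)⁴`) and E3-osc (`C₃/min depth⁴/(1+min sep)⁸`) for the transfer cube.  Then, with
`k = C₁(α/κ)⁴`, `w_{pq} = C₂(α/κ)⁴/(1+‖q−p‖)⁴`, `ω₃ = C₃(α/κ)⁴/(1+min sep)⁸`, the two torus third cumulants differ by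
at most the tempered margin `2(B_g + B_bδ) + (ω₃ + 2·6M³(δ+δ))`. [folklore] -/
theorem triple_transfer_torus_tempered (β : ℝ) {C₁ C₂ C₃ κ α M : ℝ} (hC₁ : 0 ≤ C₁) (hC₂ : 0 ≤ C₂) (hC₃ : 0 ≤ C₃)
    (hκ : 0 < κ) (hα : 0 < α) (hM : ∀ (u : Fin 4 → ℤ) (U : LGConfig 4 G), |dens G r u U| ≤ M) {RP L L' : ℕ}
    (hL : 2 * RP + 1 + 3 ≤ 2 * L + 1) (hL' : 2 * RP + 1 + 3 ≤ 2 * L' + 1)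
    {Good : Set (LGConfig 4 G)} (hGood : MeasurableSet Good) {δ : ℝ}
    (hδ : (wilsonMeasure (d := 4) (L := 2 * L + 1) r.ρ β).real ((torusLift (2 * L + 1)) ⁻¹' Good)ᶜ ≤ δ)
    (hδ' : (wilsonMeasure (d := 4) (L := 2 * L' + 1) r.ρ β).real ((torusLift (2 * L' + 1)) ⁻¹' Good)ᶜ ≤ δ)
    (H1 : ∀ ζ ∈ Good, ∀ ζ' ∈ Good, ∀ x : Fin 4 → ℤ, 1 ≤ depth (fun _ => -(RP : ℤ)) (2 * RP + 1) x →
      |kerE G r β (fun _ => -(RP : ℤ)) (2 * RP + 1) ζ (dens G r x) -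
        kerE G r β (fun _ => -(RP : ℤ)) (2 * RP + 1) ζ' (dens G r x)| ≤
        C₁ / (depth (fun _ => -(RP : ℤ)) (2 * RP + 1) x : ℝ) ^ 4)
    (H2 : ∀ ζ ∈ Good, ∀ ζ' ∈ Good, ∀ x y : Fin 4 → ℤ, 1 ≤ depth (fun _ => -(RP : ℤ)) (2 * RP + 1) x →
      1 ≤ depth (fun _ => -(RP : ℤ)) (2 * RP + 1) y →
      |kerCov G r β (fun _ => -(RP : ℤ)) (2 * RP + 1) ζ (dens G r x) (dens G r y) -
        kerCov G r β (fun _ => -(RP : ℤ)) (2 * RP + 1) ζ' (dens G r x) (dens G r y)| ≤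
        C₂ / ((min (depth (fun _ => -(RP : ℤ)) (2 * RP + 1) x) (depth (fun _ => -(RP : ℤ)) (2 * RP + 1) y) : ℕ) : ℝ) ^ 4 /
          (1 + ‖siteToE (y - x)‖) ^ 4)
    (H3 : ∀ ζ ∈ Good, ∀ ζ' ∈ Good, ∀ x y z : Fin 4 → ℤ, 1 ≤ depth (fun _ => -(RP : ℤ)) (2 * RP + 1) x →
      1 ≤ depth (fun _ => -(RP : ℤ)) (2 * RP + 1) y → 1 ≤ depth (fun _ => -(RP : ℤ)) (2 * RP + 1) z →
      |kerK3 G r β (fun _ => -(RP : ℤ)) (2 * RP + 1) ζ x y z - kerK3 G r β (fun _ => -(RP : ℤ)) (2 * RP + 1) ζ' x y z| ≤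
        C₃ / ((min (min (depth (fun _ => -(RP : ℤ)) (2 * RP + 1) x) (depth (fun _ => -(RP : ℤ)) (2 * RP + 1) y))
          (depth (fun _ => -(RP : ℤ)) (2 * RP + 1) z) : ℕ) : ℝ) ^ 4 /
          (1 + min (min ‖siteToE (y - x)‖ ‖siteToE (z - y)‖) ‖siteToE (z - x)‖) ^ 8)
    {x y z : Fin 4 → ℤ}
    (hx : κ / α ≤ (depth (fun _ => -(RP : ℤ)) (2 * RP + 1) x : ℝ) ∧ 1 ≤ depth (fun _ => -(RP : ℤ)) (2 * RP + 1) x)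
    (hy : κ / α ≤ (depth (fun _ => -(RP : ℤ)) (2 * RP + 1) y : ℝ) ∧ 1 ≤ depth (fun _ => -(RP : ℤ)) (2 * RP + 1) y)
    (hz : κ / α ≤ (depth (fun _ => -(RP : ℤ)) (2 * RP + 1) z : ℝ) ∧ 1 ≤ depth (fun _ => -(RP : ℤ)) (2 * RP + 1) z) :
    |torusK3 G r β L x y z - torusK3 G r β L' x y z| ≤
      2 * (((C₁ * (α / κ) ^ 4 + 2 * M * δ) * (C₂ * (α / κ) ^ 4 / (1 + ‖siteToE (z - y)‖) ^ 4 + 2 * (2 * M * M) * δ)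
          + (C₁ * (α / κ) ^ 4 + 2 * M * δ) * (C₂ * (α / κ) ^ 4 / (1 + ‖siteToE (z - x)‖) ^ 4 + 2 * (2 * M * M) * δ)
          + (C₁ * (α / κ) ^ 4 + 2 * M * δ) * (C₂ * (α / κ) ^ 4 / (1 + ‖siteToE (y - x)‖) ^ 4 + 2 * (2 * M * M) * δ)
          + (C₁ * (α / κ) ^ 4 + 2 * M * δ) * (C₁ * (α / κ) ^ 4 + 2 * M * δ) * (C₁ * (α / κ) ^ 4 + 2 * M * δ))
        + (4 * (M * (2 * M * M) + M * (2 * M * M) + M * (2 * M * M)) + 8 * M * M * M) * δ)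
      + (C₃ * (α / κ) ^ 4 / (1 + min (min ‖siteToE (y - x)‖ ‖siteToE (z - y)‖) ‖siteToE (z - x)‖) ^ 8
          + 2 * (6 * (M * M * M)) * (δ + δ)) := by
  obtain ⟨hxκ, hx1⟩ := hx
  obtain ⟨hyκ, hy1⟩ := hy
  obtain ⟨hzκ, hz1⟩ := hz
  have hk0 : 0 ≤ C₁ * (α / κ) ^ 4 := by positivity
  have ho : ∀ {u : Fin 4 → ℤ}, κ / α ≤ (depth (fun _ => -(RP : ℤ)) (2 * RP + 1) u : ℝ) →
      1 ≤ depth (fun _ => -(RP : ℤ)) (2 * RP + 1) u →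
      ∀ ζ ∈ Good, ∀ ζ' ∈ Good, |kerE G r β (fun _ => -(RP : ℤ)) (2 * RP + 1) ζ (dens G r u) -
        kerE G r β (fun _ => -(RP : ℤ)) (2 * RP + 1) ζ' (dens G r u)| ≤ C₁ * (α / κ) ^ 4 :=
    fun huκ hu1 ζ hζ ζ' hζ' => (H1 ζ hζ ζ' hζ' _ hu1).trans (div_pow_depth_le hC₁ hκ hα huκ)
  have hw : ∀ {p q : Fin 4 → ℤ}, κ / α ≤ (depth (fun _ => -(RP : ℤ)) (2 * RP + 1) p : ℝ) →
      1 ≤ depth (fun _ => -(RP : ℤ)) (2 * RP + 1) p → κ / α ≤ (depth (fun _ => -(RP : ℤ)) (2 * RP + 1) q : ℝ) →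
      1 ≤ depth (fun _ => -(RP : ℤ)) (2 * RP + 1) q →
      ∀ ζ ∈ Good, ∀ ζ' ∈ Good, |kerCov G r β (fun _ => -(RP : ℤ)) (2 * RP + 1) ζ (dens G r p) (dens G r q) -
        kerCov G r β (fun _ => -(RP : ℤ)) (2 * RP + 1) ζ' (dens G r p) (dens G r q)| ≤
        C₂ * (α / κ) ^ 4 / (1 + ‖siteToE (q - p)‖) ^ 4 := by
    intro p q hpκ hp1 hqκ hq1 ζ hζ ζ' hζ'
    have hpos : 0 < (1 + ‖siteToE (q - p)‖) ^ 4 := by positivity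
    have hmin : κ / α ≤ ((min (depth (fun _ => -(RP : ℤ)) (2 * RP + 1) p)
        (depth (fun _ => -(RP : ℤ)) (2 * RP + 1) q) : ℕ) : ℝ) := by
      rw [Nat.cast_min]; exact le_min hpκ hqκ
    exact (H2 ζ hζ ζ' hζ' p q hp1 hq1).trans
      (div_le_div_of_nonneg_right (div_pow_depth_le hC₂ hκ hα hmin) hpos.le)
  have hpos3 : 0 < (1 + min (min ‖siteToE (y - x)‖ ‖siteToE (z - y)‖) ‖siteToE (z - x)‖) ^ 8 := by positivity
  have hmin3 : κ / α ≤ ((min (min (depth (fun _ => -(RP : ℤ)) (2 * RP + 1) x)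
      (depth (fun _ => -(RP : ℤ)) (2 * RP + 1) y)) (depth (fun _ => -(RP : ℤ)) (2 * RP + 1) z) : ℕ) : ℝ) := by
    rw [Nat.cast_min, Nat.cast_min]; exact le_min (le_min hxκ hyκ) hzκ
  have ho3 : ∀ ζ ∈ Good, ∀ ζ' ∈ Good, |kerK3 G r β (fun _ => -(RP : ℤ)) (2 * RP + 1) ζ x y z -
      kerK3 G r β (fun _ => -(RP : ℤ)) (2 * RP + 1) ζ' x y z| ≤
      C₃ * (α / κ) ^ 4 / (1 + min (min ‖siteToE (y - x)‖ ‖siteToE (z - y)‖) ‖siteToE (z - x)‖) ^ 8 :=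
    fun ζ hζ ζ' hζ' => (H3 ζ hζ ζ' hζ' x y z hx1 hy1 hz1).trans
      (div_le_div_of_nonneg_right (div_pow_depth_le hC₃ hκ hα hmin3) hpos3.le)
  exact abs_torusK3_sub_torusK3_le_on G r β _ _ L L' hL hL' hx1 hy1 hz1 hM hGood hδ hδ' hk0 hk0 hk0
    (by positivity) (by positivity) (by positivity) (by positivity)
    (ho hxκ hx1) (ho hyκ hy1) (ho hzκ hz1) (hw hyκ hy1 hzκ hz1) (hw hxκ hx1 hzκ hz1) (hw hxκ hx1 hyκ hy1) ho3

end Torus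

end Summit.QuantumFields.YangMills.Cruxes.NT.Reference

end
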